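import Literature.Topology.FourManifolds.LatticeFormsPolarisationTypesOrthogonalOrbits
import HarnessLib

/-!
# The number of polarisation types of divisor `f` with `w = 1` in `L_{2t} = B₀ ⊕ ⟨−2t⟩`: the admissible classes
# `c mod f` number `2^{ρ(f)}` (`f` odd) resp. `2^{ρ(f/2)}` (`f` even) as soon as one exists
# (Gritsenko–Hulek–Sankaran, *Compositio Math.* 146 (2010), §4 Prop. 4.6 (i)–(iii) in the case `w = 1`)

Trunk T-4MAN vocabulary; sequel of `LatticeFormsPolarisationTypesGeneralDivisor.lean` (row g43-#2: the `Õ(L)`-orbits of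
primitive `h ∈ L = B₀ ⊕ ⟨−2t⟩` with `h² = 2d`, `(h, L) = fℤ` are in bijection with the admissible classes
`{c mod f : (c, f) = 1, f² ∣ d + c²t}`, `natCard_quot_stable_isometryEquiv_two_mul_of_divisor`), of
`LatticeFormsPolarisationTypesOrthogonalOrbits.lean` (row g44-#1: Cor. 4.7, and the arithmetic of `w = 1`:
`gcd_eq_one_of_w_eq_one`) and of `LatticeFormsRankOneDiscriminantFormIsometries.lean` (g39: the counts
`#{y ∈ ℤ/m : y² = 1} = 2^{ω(m)}` for odd `m` and `#{u ∈ ℤ/2n : 4n ∣ u² − 1} = 2^{ω(n)}`). Written for lane `lit-hodgefound`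
(Track 2 foundations; prover seat `lit-hodgefound-p18`, gen 44, row g44-#3). THEOREMS ONLY — no definition, no named fact,
no instance, no notation.

## Source, verbatim (V. Gritsenko, K. Hulek, G. K. Sankaran, Compositio Math. 146 (2010) 404–434, arXiv numbering §4,
held text `paper:arxiv-0802.2078` pp. 10–11)

"**Proposition 4.6.** Let `h_d ∈ L_{2t}` be primitive of length `2d > 0` and `div(h_d) = f`. We put `g = (2t/f, 2d/f)`,
`w = (g, f)`, `g = wg₁`, `f = wf₁`. Then `2t = fgt₁ = w²f₁g₁t₁` and `2d = fgd₁ = w²f₁g₁d₁` where `(t₁, d₁) = (f₁, g₁) = 1`.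
(i) If `g₁` is even, then such an `h_d` exists if and only if `(d₁, f₁) = (f₁, t₁) = 1` and `−d₁/t₁` is a quadratic residue
modulo `f₁`. Moreover the number of `Õ(L_{2t})`-orbits of `h_d` with fixed `f` (if at least one `h_d` exists) is equal to
`w₊(f₁)φ(w₋(f₁)) · 2^{ρ(f₁)}`, where `w = w₊(f₁)w₋(f₁)` and `w₊(f₁)` is the product of all powers of primes dividing `(w, f₁)`,
`ρ(n)` is the number of prime factors of `n` and `φ(n)` is the Euler function. (ii) If `g₁` is odd, and `f₁` is even or
`f₁` and `d₁` are both odd, then such an `h_d` exists if and only if `(d₁, f₁) = (t₁, 2f₁) = 1` and `−d₁/t₁` is a quadratic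
residue modulo `2f₁`. The number of `Õ(L_{2t})`-orbits of such `h_d` is equal to `w₊(f₁)φ(w₋(f₁)) · 2^{ρ(f₁/2)}` if
`f₁ ≡ 0 mod 2` and to `w₊(f₁)φ(w₋(f₁)) · 2^{ρ(f₁)}` if `f₁ ≡ d₁ ≡ 1 mod 2`. (iii) If `g₁` and `f₁` are both odd and `d₁` is
even, then such an `h_d` exists if and only if `(d₁, f₁) = (t₁, 2f₁) = 1`, `−d₁/(4t₁)` is a quadratic residue modulo
`f₁` and `w` is odd. The number of `Õ(L_{2t})`-orbits of such `h_d` is equal to `w₊(f₁)φ(w₋(f₁)) · 2^{ρ(f₁)}`. […]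
*Proof.* […] the `Õ(L_{2t})`-orbit of `h_d` is […] determined by `c mod f` […] Because `f₁` is odd, the number of
solutions `c₁` of (c1-cong0) taken modulo `f₁` is equal to `#{x mod f₁ ∣ x² ≡ 1 mod f₁} = 2^{ρ(f₁)}`. […] Since
`(f₁, d₁) = 1` we know that `d₁` is odd. Therefore `#{c₁ mod f₁ ∣ c₁² ≡ −d₁/t₁ mod 2f₁} = 2^{ρ(f₁/2)}` if `−d₁/t₁` is a
quadratic residue mod `2f₁`." […] "**Example 4.10.** Let `f = 2`. […] Moreover the `Õ(L_{2t})`-orbit of `h_d` is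
unique […]. If `f > 2`, then Proposition 4.6 shows that the number of orbits is zero or strictly greater than one. Thus
the cases `f = 1` and `f = 2` are special in that they are the only cases where the degree determines the polarisation
uniquely." (p. 12)

## Reading notes

* THE CASE FORMALISED: `w = 1`. Then `f₁ = f`, `w₊(f₁) = w₋(f₁) = 1`, `φ(1) = 1`, and the three printed counts collapse to:
  **`2^{ρ(f)}` if `f` is odd** ((i), (ii) with `f₁ ≡ d₁ ≡ 1`, (iii)) and **`2^{ρ(f/2)}` if `f` is even** ((ii) with
  `f₁ ≡ 0 mod 2`), "if at least one `h_d` exists". The existence criteria by quadratic residues are not restated: as in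
  Cor. 4.7 the hypothesis is the existence of one admissible `c` (equivalently, by `exists_primitive_apply_self_eq_snd_eq_iff`
  of the g43 file, of one such vector). TODO(general form): `w > 1` (the factor `w₊(f₁)φ(w₋(f₁))`).
* By `gcd_eq_one_of_w_eq_one` (g44-#1), for types that occur `w = 1` is the same as `(f, 2t/f) = 1`; the arithmetic is done
  under the latter and the lattice statements (§3) are given under the printed `w = ((2t/f, 2d/f), f) = 1`.
* THE COUNT ("the number of solutions `c₁` … is equal to `#{x mod f₁ ∣ x² ≡ 1 mod f₁}`"): with one admissible `c₀` fixed,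
  `c ↦ c/c₀` is a bijection of the admissible classes onto the square roots of `1` — modulo `f` if `f` is odd (then
  `f² ∣ d + c²t ⟺ f ∣ c² − c₀²`, §1), and, for `f = 2n`, onto `{u mod 2n : u² ≡ 1 (mod 4n)}` (then `f² ∣ d + c²t ⟺
  2f ∣ c² − c₀²`, §1); the two root counts are the tree's `natCard_sq_eq_one_zmod_of_odd` and
  `natCard_zmod_two_mul_sq_sub_one_dvd`.
* "IF `f > 2` … ZERO OR STRICTLY GREATER THAN ONE" (§5, no hypothesis on `w`): the printed justification is the list of
  counts in Prop. 4.6 (i)–(iii); here it is proved directly and slightly more sharply — `c ↦ −c` is a fixed-point-free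
  involution of the admissible classes `{c ∈ (ℤ/f)^× : f² ∣ d + c²t}` as soon as `f > 2` (`c ≡ −c` would force `f ∣ 2`), so
  their number, which is the number of `Õ(L)`-orbits (g43 `natCard_quot_stable_isometryEquiv_two_mul_of_divisor`), is EVEN.
  "The only cases where the degree determines the polarisation uniquely" is rendered as: exactly one `Õ(L)`-orbit ⟹ `f ≤ 2`
  (the converse direction — one orbit for `f = 1`, and for `f = 2` when `4 ∣ d + t` — is Examples 4.8/4.10 in
  `LatticeFormsPolarisationTypesSplitNonsplit.lean`).

## Contents (all proved)

* §1 arithmetic: `sq_dvd_add_mul_sq_iff_dvd_sq_sub_sq_of_coprime` (`f` odd: `f² ∣ d + c²t ⟺ f ∣ c² − c₀²`),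
  `sq_dvd_add_mul_sq_iff_four_mul_dvd_sq_sub_sq` (`f = 2n`: `⟺ 4n ∣ c² − c₀²`), `four_mul_dvd_sq_sub_sq_of_dvd_sub`
  (`2n ∣ x − y ⟹ 4n ∣ x² − y²`).
* §2 **`natCard_admissible_eq_two_pow_of_odd`** (`#{c ∈ (ℤ/f)^× : f² ∣ d + c²t} = 2^{ρ(f)}`, `f` odd, `(f, 2t/f) = 1`, one
  admissible `c₀` given) and **`natCard_admissible_eq_two_pow_of_even`** (`= 2^{ρ(n)}` for `f = 2n`).
* §3 `L = B₀ ⊕ ⟨−2t⟩` (`B₀` even unimodular, two orthogonal hyperbolic pairs, `t ≥ 1`), under the printed `w = 1` and the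
  existence of one primitive `h` with `h² = 2d`, `(h, L) = fℤ`: the `Õ(L)`-orbits of such vectors number
  **`2^{ρ(f)}`** (`natCard_quot_stable_isometryEquiv_two_mul_of_divisor_of_odd`) resp. **`2^{ρ(f/2)}`**
  (`natCard_quot_stable_isometryEquiv_two_mul_of_divisor_of_even`), versus ONE `O(L)`-orbit (Cor. 4.7,
  `natCard_quot_isometryEquiv_two_mul_of_divisor_of_w_eq_one`); and the same for the models
  `(E₈(−1)^{⊕m} ⊕ U^{⊕(k+2)}) ⊕ ℤ(−2t)` (`…_model_…`).
* §5 (appended, row g44-#9; Example 4.10, second paragraph) **`f > 2` ⟹ the number of `Õ(L)`-orbits is even, hence zero or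
  at least two; one orbit ⟹ `f ≤ 2`**: `even_natCard_admissible_of_two_lt`,
  **`even_natCard_quot_stable_isometryEquiv_two_mul_of_divisor_of_two_lt`**,
  `natCard_quot_stable_isometryEquiv_two_mul_of_divisor_eq_zero_or_two_le`,
  **`le_two_of_natCard_quot_stable_isometryEquiv_two_mul_of_divisor_eq_one`**, and the model versions (`…_model_…`).

## References

* [GritsenkoHulekSankaran2010Symplectic] V. Gritsenko, K. Hulek, G. K. Sankaran, Moduli spaces of irreducible symplectic
  manifolds, Compositio Math. 146 (2010) 404–434 (arXiv:0802.2078): §4 Prop. 4.6 (i)–(iii) and proof, Cor. 4.7,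
  Example 4.10.
* [GritsenkoHulekSankaran2007HM] V. Gritsenko, K. Hulek, G. K. Sankaran, The Hirzebruch–Mumford volume for the orthogonal
  group and applications, Doc. Math. 12 (2007): §4 proof of Lemma 4.3 (`#{x mod 2d : x² ≡ 1 mod 4d} = 2^{ρ(d)}`).
* [KumanduriRomero1997] R. Kumanduri, C. Romero, Number theory with computer applications, Prentice Hall 1997, §9.3
  (square roots modulo prime powers).
-/

noncomputable section

open Module Function
open LinearMap (BilinForm)
open LinearMap.BilinForm

namespace Literature.Topology.FourManifolds

universe u

/-! ### §1 `f² ∣ d + c²t` as a congruence on `c²` relative to one solution `c₀` -/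

section Arithmetic

/-- **`f` odd (so `t = f t'`, `(f, t') = 1` when `(f, 2t/f) = 1`): `f² ∣ d + c²t ⟺ f ∣ c² − c₀²`** for a fixed solution `c₀`
of `f² ∣ d + c₀²t` — the reduction of "(c-eq)" to the congruence "`t₁c₁² ≡ −d₁ mod f₁`", read relative to one solution.
[cite: GritsenkoHulekSankaran2010Symplectic, §4 proof of Prop. 4.6 (i) (displays (c-eq), (c1-cong0))] -/
theorem sq_dvd_add_mul_sq_iff_dvd_sq_sub_sq_of_coprime {f t t' d c₀ : ℤ} (hf0 : f ≠ 0) (ht : t = f * t')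
    (hcop : IsCoprime f t') (h₀ : f ^ 2 ∣ d + t * c₀ ^ 2) (c : ℤ) : f ^ 2 ∣ d + t * c ^ 2 ↔ f ∣ c ^ 2 - c₀ ^ 2 := by
  have e : d + t * c ^ 2 = (d + t * c₀ ^ 2) + f * (t' * (c ^ 2 - c₀ ^ 2)) := by rw [ht]; ring
  rw [e, dvd_add_right h₀, sq f, mul_dvd_mul_iff_left hf0]
  exact ⟨fun h ↦ hcop.dvd_of_dvd_mul_left h, fun h ↦ h.mul_left t'⟩

/-- **`f = 2n` even (so `t = n m`, `(4n, m) = 1` when `(f, 2t/f) = 1`): `f² ∣ d + c²t ⟺ 4n ∣ c² − c₀²`** for a fixed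
solution `c₀` — the reduction of "(c-eq)" to the congruence "`t₁c₁² ≡ −d₁ mod 2f₁`", read relative to one solution.
[cite: GritsenkoHulekSankaran2010Symplectic, §4 proof of Prop. 4.6 (ii) (display (c1-cong1-1))] -/
theorem sq_dvd_add_mul_sq_iff_four_mul_dvd_sq_sub_sq {n t m d c₀ : ℤ} (hn0 : n ≠ 0) (ht : t = n * m)
    (hcop : IsCoprime (4 * n) m) (h₀ : (2 * n) ^ 2 ∣ d + t * c₀ ^ 2) (c : ℤ) :
    (2 * n) ^ 2 ∣ d + t * c ^ 2 ↔ 4 * n ∣ c ^ 2 - c₀ ^ 2 := by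
  have e : d + t * c ^ 2 = (d + t * c₀ ^ 2) + n * (m * (c ^ 2 - c₀ ^ 2)) := by rw [ht]; ring
  have e2 : (2 * n) ^ 2 = n * (4 * n) := by ring
  rw [e, dvd_add_right h₀, e2, mul_dvd_mul_iff_left hn0]
  exact ⟨fun h ↦ hcop.dvd_of_dvd_mul_left h, fun h ↦ h.mul_left m⟩

/-- `2n ∣ x − y ⟹ 4n ∣ x² − y²` (`x² − y² = (x − y)² + 2y(x − y)`): the condition `u² ≡ 1 (mod 4n)` depends only on
`u mod 2n`. [cite: GritsenkoHulekSankaran2007HM, §4 proof of Lemma 4.3 ("This congruence has `2^{ρ(d)}` solutions modulo `2d`")] -/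
theorem four_mul_dvd_sq_sub_sq_of_dvd_sub {n x y : ℤ} (h : 2 * n ∣ x - y) : 4 * n ∣ x ^ 2 - y ^ 2 := by
  obtain ⟨k, hk⟩ := h
  exact ⟨n * k ^ 2 + k * y, by linear_combination (x + y + 2 * n * k) * hk⟩

end Arithmetic

/-! ### §2 The number of admissible classes `c mod f` for `(f, 2t/f) = 1` -/

section Count

/-- **Prop. 4.6, the count for `w = 1` and odd `f`: `#{c mod f : (c, f) = 1, f² ∣ d + c²t} = 2^{ρ(f)}`** as soon as one
admissible `c₀` exists (`(f, 2t/f) = 1`): "`#{x mod f₁ ∣ x² ≡ 1 mod f₁} = 2^{ρ(f₁)}`", `c ↦ c/c₀` being a bijection onto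
the square roots of `1` modulo `f`. [cite: GritsenkoHulekSankaran2010Symplectic, §4 Prop. 4.6 (i)–(iii) and proof of (i)] -/
theorem natCard_admissible_eq_two_pow_of_odd {t : ℕ} {d : ℤ} {f : ℕ} (hfo : Odd f) (hft : (f : ℤ) ∣ 2 * t)
    (hcop : Int.gcd (f : ℤ) (2 * t / f) = 1) {c₀ : ℤ} (hc₀ : Int.gcd (f : ℤ) c₀ = 1) (hd₀ : (f : ℤ) ^ 2 ∣ d + t * c₀ ^ 2) :
    Nat.card {c : ZMod f // IsUnit c ∧ (f : ℤ) ^ 2 ∣ d + t * (c.val : ℤ) ^ 2} = 2 ^ f.primeFactors.card := by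
  obtain ⟨k, hk⟩ := hfo
  haveI : NeZero f := ⟨by omega⟩
  have hf0 : (f : ℤ) ≠ 0 := by exact_mod_cast (show f ≠ 0 by omega)
  -- `f` odd, `f ∣ 2t` ⟹ `t = f t'`, `2t/f = 2t'`, `(f, t') = 1`
  have hf2 : IsCoprime (f : ℤ) 2 := ⟨1, -(k : ℤ), by rw [hk]; push_cast; ring⟩
  obtain ⟨t', ht'⟩ : (f : ℤ) ∣ t := hf2.dvd_of_dvd_mul_left hft
  have hdiv : 2 * (t : ℤ) / f = 2 * t' := by
    rw [show 2 * (t : ℤ) = f * (2 * t') by rw [ht']; ring, Int.mul_ediv_cancel_left _ hf0]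
  rw [hdiv] at hcop
  have hcop' : IsCoprime (f : ℤ) t' := (Int.isCoprime_iff_gcd_eq_one.2 hcop).of_mul_right_right
  -- the unit `γ = c₀ mod f`
  have hu0 : IsUnit ((c₀ : ℤ) : ZMod f) :=
    (ZMod.coe_int_isUnit_iff_isCoprime _ _).2 (Int.isCoprime_iff_gcd_eq_one.2 hc₀)
  set γ : (ZMod f)ˣ := hu0.unit with hγdef
  have hγ : (γ : ZMod f) = (c₀ : ZMod f) := hu0.unit_spec
  -- admissibility ⟺ `c² = c₀²` in `ℤ/f`
  have key : ∀ c : ZMod f, ((f : ℤ) ^ 2 ∣ d + t * (c.val : ℤ) ^ 2) ↔ c ^ 2 = (γ : ZMod f) ^ 2 := fun c ↦ by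
    rw [sq_dvd_add_mul_sq_iff_dvd_sq_sub_sq_of_coprime hf0 ht' hcop' hd₀, ← ZMod.intCast_zmod_eq_zero_iff_dvd,
      Int.cast_sub, Int.cast_pow, Int.cast_pow, Int.cast_natCast, ZMod.natCast_zmod_val, sub_eq_zero, hγ]
  rw [← natCard_sq_eq_one_zmod_of_odd ⟨k, hk⟩]
  refine Nat.card_congr
    { toFun := fun c ↦ ⟨c.1 * ↑γ⁻¹, ?_⟩
      invFun := fun y ↦ ⟨y.1 * γ, ?_, ?_⟩
      left_inv := fun c ↦ Subtype.ext (Units.inv_mul_cancel_right _ _)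
      right_inv := fun y ↦ Subtype.ext (Units.mul_inv_cancel_right _ _) }
  · rw [mul_pow, (key c.1).1 c.2.2, ← mul_pow, Units.mul_inv, one_pow]
  · exact (IsUnit.of_mul_eq_one y.1 (by rw [← sq]; exact y.2)).mul γ.isUnit
  · exact (key _).2 (by rw [mul_pow, y.2, one_mul])

/-- **Prop. 4.6, the count for `w = 1` and even `f = 2n`: `#{c mod 2n : (c, 2n) = 1, (2n)² ∣ d + c²t} = 2^{ρ(n)}`** as soon
as one admissible `c₀` exists (`(2n, 2t/2n) = 1`): "`#{c₁ mod f₁ ∣ c₁² ≡ −d₁/t₁ mod 2f₁} = 2^{ρ(f₁/2)}`", `c ↦ c/c₀` being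
a bijection onto `{u mod 2n : u² ≡ 1 (mod 4n)}`. [cite: GritsenkoHulekSankaran2010Symplectic, §4 Prop. 4.6 (ii) and its proof] [cite: GritsenkoHulekSankaran2007HM, §4 proof of Lemma 4.3] -/
theorem natCard_admissible_eq_two_pow_of_even {t : ℕ} {d : ℤ} {n : ℕ} (hn : 0 < n) (hft : (2 * n : ℤ) ∣ 2 * t)
    (hcop : Int.gcd (2 * n : ℤ) (2 * t / (2 * n)) = 1) {c₀ : ℤ} (hc₀ : Int.gcd (2 * n : ℤ) c₀ = 1)
    (hd₀ : (2 * n : ℤ) ^ 2 ∣ d + t * c₀ ^ 2) :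
    Nat.card {c : ZMod (2 * n) // IsUnit c ∧ ((2 * n : ℕ) : ℤ) ^ 2 ∣ d + t * (c.val : ℤ) ^ 2} =
      2 ^ n.primeFactors.card := by
  haveI : NeZero (2 * n) := ⟨by omega⟩
  have hn0 : (n : ℤ) ≠ 0 := by exact_mod_cast hn.ne'
  have h2n0 : (2 * n : ℤ) ≠ 0 := by positivity
  -- `t = n m`, `2t/2n = m`, `(2n, m) = 1`, hence `(4n, m) = 1`
  obtain ⟨m, hm⟩ : (n : ℤ) ∣ t := (mul_dvd_mul_iff_left (two_ne_zero (α := ℤ))).1 hft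
  have hdiv : 2 * (t : ℤ) / (2 * n) = m := by
    rw [show 2 * (t : ℤ) = 2 * n * m by rw [hm]; ring, Int.mul_ediv_cancel_left _ h2n0]
  rw [hdiv] at hcop
  have hcop2 : IsCoprime (2 * n : ℤ) m := Int.isCoprime_iff_gcd_eq_one.2 hcop
  have hcop4 : IsCoprime (4 * n : ℤ) m := by
    rw [show (4 * n : ℤ) = 2 * (2 * n) by ring]
    exact hcop2.of_mul_left_left.mul_left hcop2
  -- the unit `γ = c₀ mod 2n` and the lift `j` of `γ⁻¹`
  have hu0 : IsUnit ((c₀ : ℤ) : ZMod (2 * n)) :=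
    (ZMod.coe_int_isUnit_iff_isCoprime _ _).2 (by push_cast; exact Int.isCoprime_iff_gcd_eq_one.2 hc₀)
  set γ : (ZMod (2 * n))ˣ := hu0.unit with hγdef
  have hγ : (γ : ZMod (2 * n)) = (c₀ : ZMod (2 * n)) := hu0.unit_spec
  have hcast : ∀ c : ZMod (2 * n), ((c.val : ℤ) : ZMod (2 * n)) = c := fun c ↦ by
    rw [Int.cast_natCast, ZMod.natCast_zmod_val]
  -- `2n ∣ c₀ · j − 1` for the lift `j` of `γ⁻¹`, hence `4n ∣ (c₀ j)² − 1`
  set j : ℤ := (((γ⁻¹ : (ZMod (2 * n))ˣ) : ZMod (2 * n)).val : ℤ) with hjdef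
  have hj : (2 * n : ℤ) ∣ c₀ * j - 1 := by
    have h1 : ((c₀ * j : ℤ) : ZMod (2 * n)) = ((1 : ℤ) : ZMod (2 * n)) := by
      rw [Int.cast_mul, hjdef, hcast, ← hγ, Units.mul_inv, Int.cast_one]
    have h2 := (ZMod.intCast_eq_intCast_iff_dvd_sub _ _ (2 * n)).1 h1.symm
    exact_mod_cast h2
  have hj2 : (4 * n : ℤ) ∣ (c₀ * j) ^ 2 - 1 := by
    have h := four_mul_dvd_sq_sub_sq_of_dvd_sub (n := n) (x := c₀ * j) (y := 1) hj
    rwa [one_pow] at h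
  have key : ∀ c : ZMod (2 * n), (((2 * n : ℕ) : ℤ) ^ 2 ∣ d + t * (c.val : ℤ) ^ 2) ↔
      (4 * n : ℤ) ∣ (c.val : ℤ) ^ 2 - c₀ ^ 2 := fun c ↦ by
    push_cast
    exact sq_dvd_add_mul_sq_iff_four_mul_dvd_sq_sub_sq hn0 hm hcop4 hd₀ _
  rw [← natCard_zmod_two_mul_sq_sub_one_dvd hn]
  refine Nat.card_congr
    { toFun := fun c ↦ ⟨c.1 * ↑γ⁻¹, ?_⟩
      invFun := fun u ↦ ⟨u.1 * γ, ?_, ?_⟩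
      left_inv := fun c ↦ Subtype.ext (Units.inv_mul_cancel_right _ _)
      right_inv := fun u ↦ Subtype.ext (Units.mul_inv_cancel_right _ _) }
  · -- `(c/c₀)² ≡ (c j)² = j²(c² − c₀²) + ((c₀ j)² − 1) + 1 (mod 4n)`
    have h1 : (2 * n : ℤ) ∣ (c.1.val : ℤ) * j - ((c.1 * ↑γ⁻¹ : ZMod (2 * n)).val : ℤ) := by
      have e : (((c.1 * ↑γ⁻¹ : ZMod (2 * n)).val : ℤ) : ZMod (2 * n)) = (((c.1.val : ℤ) * j : ℤ) : ZMod (2 * n)) := by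
        rw [hcast, Int.cast_mul, hcast, hjdef, hcast]
      exact_mod_cast (ZMod.intCast_eq_intCast_iff_dvd_sub _ _ (2 * n)).1 e
    have h2 := four_mul_dvd_sq_sub_sq_of_dvd_sub h1
    have h3 : (4 * n : ℤ) ∣ ((c.1.val : ℤ) * j) ^ 2 - 1 := by
      have e : ((c.1.val : ℤ) * j) ^ 2 - 1 = j ^ 2 * ((c.1.val : ℤ) ^ 2 - c₀ ^ 2) + ((c₀ * j) ^ 2 - 1) := by ring
      rw [e]
      exact dvd_add (((key c.1).1 c.2.2).mul_left _) hj2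
    have h4 := dvd_sub h3 h2
    have e : ((c.1.val : ℤ) * j) ^ 2 - 1 - (((c.1.val : ℤ) * j) ^ 2 - ((c.1 * ↑γ⁻¹ : ZMod (2 * n)).val : ℤ) ^ 2) =
        ((c.1 * ↑γ⁻¹ : ZMod (2 * n)).val : ℤ) ^ 2 - 1 := by ring
    rwa [e] at h4
  · -- `u² ≡ 1 (mod 4n)` ⟹ `u` is a unit mod `2n`
    have h1 : (u.1 : ZMod (2 * n)) ^ 2 = 1 := by
      have h2 : (2 * n : ℤ) ∣ (u.1.val : ℤ) ^ 2 - 1 := (Dvd.intro 2 (by ring)).trans u.2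
      have h3 := (ZMod.intCast_eq_intCast_iff_dvd_sub 1 ((u.1.val : ℤ) ^ 2) (2 * n)).2 (by push_cast; exact h2)
      rw [Int.cast_pow, hcast, Int.cast_one] at h3
      exact h3.symm
    exact (IsUnit.of_mul_eq_one u.1 (by rw [← sq]; exact h1)).mul γ.isUnit
  · -- `(u c₀)² − c₀² = c₀²(u² − 1) ≡ 0 (mod 4n)`
    refine (key _).2 ?_
    have h1 : (2 * n : ℤ) ∣ (u.1.val : ℤ) * c₀ - ((u.1 * ↑γ : ZMod (2 * n)).val : ℤ) := by
      have e : (((u.1 * ↑γ : ZMod (2 * n)).val : ℤ) : ZMod (2 * n)) = (((u.1.val : ℤ) * c₀ : ℤ) : ZMod (2 * n)) := by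
        rw [hcast, Int.cast_mul, hcast, hγ]
      exact_mod_cast (ZMod.intCast_eq_intCast_iff_dvd_sub _ _ (2 * n)).1 e
    have h2 := four_mul_dvd_sq_sub_sq_of_dvd_sub h1
    have h3 : (4 * n : ℤ) ∣ ((u.1.val : ℤ) * c₀) ^ 2 - c₀ ^ 2 := by
      have e : ((u.1.val : ℤ) * c₀) ^ 2 - c₀ ^ 2 = c₀ ^ 2 * ((u.1.val : ℤ) ^ 2 - 1) := by ring
      rw [e]
      exact u.2.mul_left _
    have h4 := dvd_sub h3 h2
    have e : ((u.1.val : ℤ) * c₀) ^ 2 - c₀ ^ 2 - (((u.1.val : ℤ) * c₀) ^ 2 - ((u.1 * ↑γ : ZMod (2 * n)).val : ℤ) ^ 2) =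
        ((u.1 * ↑γ : ZMod (2 * n)).val : ℤ) ^ 2 - c₀ ^ 2 := by ring
    rwa [e] at h4

end Count

/-! ### §3 The number of `Õ(L)`-orbits of polarisation vectors of divisor `f` with `w = 1` in `L = B₀ ⊕ ⟨−2t⟩` -/

section Lattice

variable {M : Type u} [AddCommGroup M] [Module.Finite ℤ M] [Module.Free ℤ M] {B₀ : BilinForm ℤ M} (t : ℕ)

/-- From one primitive `h ∈ B₀ ⊕ ⟨−2t⟩` with `h² = 2d`, `(h, L) = fℤ` and `w = ((2t/f, 2d/f), f) = 1`: `f ≠ 0`, `f ∣ 2t`,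
`(f, 2t/f) = 1`, and the `l_t`-coordinate `c₀ = h.2` is admissible (`(f, c₀) = 1`, `f² ∣ d + c₀²t`) — the data of Prop. 4.6's
proof for that vector. (`B₀` even unimodular, `t ≥ 1`.) [cite: GritsenkoHulekSankaran2010Symplectic, §4 proof of Prop. 4.6, first paragraph] -/
theorem divisor_data_of_w_eq_one (hu : B₀.IsUnimodular) (he : B₀.IsEven) (ht : 0 < t) {r r' : M × ℤ} {f d : ℤ}
    (hw : Int.gcd (Int.gcd (2 * t / f) (2 * d / f) : ℤ) f = 1)
    (hr : B₀.prod ((-(2 * t : ℤ)) • LinearMap.mul ℤ ℤ) r r = 2 * d) (hr0 : r ≠ 0)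
    (hrsat : ∀ (k : ℤ) (w : M × ℤ), k ≠ 0 → k • w ∈ ℤ ∙ r → w ∈ ℤ ∙ r)
    (hfr : ∀ z, f ∣ B₀.prod ((-(2 * t : ℤ)) • LinearMap.mul ℤ ℤ) r z)
    (hr' : B₀.prod ((-(2 * t : ℤ)) • LinearMap.mul ℤ ℤ) r r' = f) :
    f ≠ 0 ∧ f ∣ 2 * t ∧ Int.gcd f (2 * t / f) = 1 ∧ Int.gcd f r.2 = 1 ∧ f ^ 2 ∣ d + t * r.2 ^ 2 := by
  haveI : Module.IsTorsionFree ℤ M := inferInstance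
  have hf0 : f ≠ 0 := by
    rintro rfl
    exact hr0 ((nondegenerate_prod_neg_twoMul_smul_mul B₀ t hu ht).1 r fun z ↦ zero_dvd_iff.1 (hfr z))
  have hc : Int.gcd f r.2 = 1 := gcd_snd_eq_one_of_primitive_of_forall_dvd t hu hr0 hrsat hfr
  have hd : f ^ 2 ∣ d + t * r.2 ^ 2 := sq_dvd_add_mul_snd_sq_of_forall_dvd t hu he hr hfr
  have hft : f ∣ 2 * t :=
    (Int.isCoprime_iff_gcd_eq_one.2 hc).dvd_of_dvd_mul_right (dvd_two_mul_mul_snd_of_forall_dvd t hfr)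
  have hfd : f ∣ 2 * d := by rw [← hr]; exact hfr r
  have hm : 2 * (t : ℤ) = f * (2 * t / f) := (Int.mul_ediv_cancel' hft).symm
  have hde : 2 * d = f * (2 * d / f) := (Int.mul_ediv_cancel' hfd).symm
  exact ⟨hf0, hft, gcd_eq_one_of_w_eq_one hf0 hm hde hd hw, hc, hd⟩

/-- **Prop. 4.6 (i)–(iii) for `w = 1`, `f` odd: the `Õ(L)`-orbits of primitive `h ∈ L = B₀ ⊕ ⟨−2t⟩` with `h² = 2d`,
`(h, L) = fℤ` number `2^{ρ(f)}`** "if at least one `h_d` exists" (`w₊(f₁)φ(w₋(f₁)) · 2^{ρ(f₁)}` with `w = 1`, `f₁ = f`) — while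
they form a single `O(L)`-orbit (Cor. 4.7, `natCard_quot_isometryEquiv_two_mul_of_divisor_of_w_eq_one`). `B₀` even unimodular
with two orthogonal hyperbolic pairs, `t ≥ 1`. [cite: GritsenkoHulekSankaran2010Symplectic, §4 Prop. 4.6 (i)–(iii)] -/
theorem natCard_quot_stable_isometryEquiv_two_mul_of_divisor_of_odd (hu : B₀.IsUnimodular) (he : B₀.IsEven) (ht : 0 < t)
    {x y x₁ y₁ : M} (h : TwoHyperbolicPairs B₀ x y x₁ y₁) (d : ℤ) {f : ℕ} (hfo : Odd f)
    (hw : Int.gcd (Int.gcd (2 * t / f) (2 * d / f) : ℤ) f = 1)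
    (hex : ∃ r r' : M × ℤ, B₀.prod ((-(2 * t : ℤ)) • LinearMap.mul ℤ ℤ) r r = 2 * d ∧ r ≠ 0 ∧
      (∀ (k : ℤ) (w : M × ℤ), k ≠ 0 → k • w ∈ ℤ ∙ r → w ∈ ℤ ∙ r) ∧
      (∀ z, (f : ℤ) ∣ B₀.prod ((-(2 * t : ℤ)) • LinearMap.mul ℤ ℤ) r z) ∧ B₀.prod ((-(2 * t : ℤ)) • LinearMap.mul ℤ ℤ) r r' = f) :
    Nat.card (Quot fun r s : {r : M × ℤ // B₀.prod ((-(2 * t : ℤ)) • LinearMap.mul ℤ ℤ) r r = 2 * d ∧ r ≠ 0 ∧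
        (∀ (k : ℤ) (w : M × ℤ), k ≠ 0 → k • w ∈ ℤ ∙ r → w ∈ ℤ ∙ r) ∧
        (∀ z, (f : ℤ) ∣ B₀.prod ((-(2 * t : ℤ)) • LinearMap.mul ℤ ℤ) r z) ∧
        ∃ r', B₀.prod ((-(2 * t : ℤ)) • LinearMap.mul ℤ ℤ) r r' = f} ↦
      ∃ g : (B₀.prod ((-(2 * t : ℤ)) • LinearMap.mul ℤ ℤ)).IsometryEquiv (B₀.prod ((-(2 * t : ℤ)) • LinearMap.mul ℤ ℤ)),
        g.discriminantGroupCongr = LinearEquiv.refl ℤ _ ∧ g r.1 = s.1) = 2 ^ f.primeFactors.card := by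
  obtain ⟨r, r', hr, hr0, hrsat, hfr, hr'⟩ := hex
  obtain ⟨hf0, hft, hcop, hc, hd⟩ := divisor_data_of_w_eq_one t hu he ht hw hr hr0 hrsat hfr hr'
  have hf0' : 0 < f := by omega
  rw [natCard_quot_stable_isometryEquiv_two_mul_of_divisor t hu he ht h d hf0' hft]
  exact natCard_admissible_eq_two_pow_of_odd hfo hft hcop hc hd

/-- **Prop. 4.6 (ii) for `w = 1`, `f = 2n` even: the `Õ(L)`-orbits of primitive `h ∈ L = B₀ ⊕ ⟨−2t⟩` with `h² = 2d`,
`(h, L) = 2nℤ` number `2^{ρ(n)}`** if at least one exists (`w₊(f₁)φ(w₋(f₁)) · 2^{ρ(f₁/2)}` with `w = 1`, `f₁ = f = 2n`) — versus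
a single `O(L)`-orbit (Cor. 4.7). `B₀` even unimodular with two orthogonal hyperbolic pairs, `t ≥ 1`.
[cite: GritsenkoHulekSankaran2010Symplectic, §4 Prop. 4.6 (ii)] -/
theorem natCard_quot_stable_isometryEquiv_two_mul_of_divisor_of_even (hu : B₀.IsUnimodular) (he : B₀.IsEven) (ht : 0 < t)
    {x y x₁ y₁ : M} (h : TwoHyperbolicPairs B₀ x y x₁ y₁) (d : ℤ) {n : ℕ} (hn : 0 < n)
    (hw : Int.gcd (Int.gcd (2 * t / (2 * n)) (2 * d / (2 * n)) : ℤ) (2 * n) = 1)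
    (hex : ∃ r r' : M × ℤ, B₀.prod ((-(2 * t : ℤ)) • LinearMap.mul ℤ ℤ) r r = 2 * d ∧ r ≠ 0 ∧
      (∀ (k : ℤ) (w : M × ℤ), k ≠ 0 → k • w ∈ ℤ ∙ r → w ∈ ℤ ∙ r) ∧
      (∀ z, (2 * n : ℤ) ∣ B₀.prod ((-(2 * t : ℤ)) • LinearMap.mul ℤ ℤ) r z) ∧
      B₀.prod ((-(2 * t : ℤ)) • LinearMap.mul ℤ ℤ) r r' = 2 * n) :
    Nat.card (Quot fun r s : {r : M × ℤ // B₀.prod ((-(2 * t : ℤ)) • LinearMap.mul ℤ ℤ) r r = 2 * d ∧ r ≠ 0 ∧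
        (∀ (k : ℤ) (w : M × ℤ), k ≠ 0 → k • w ∈ ℤ ∙ r → w ∈ ℤ ∙ r) ∧
        (∀ z, ((2 * n : ℕ) : ℤ) ∣ B₀.prod ((-(2 * t : ℤ)) • LinearMap.mul ℤ ℤ) r z) ∧
        ∃ r', B₀.prod ((-(2 * t : ℤ)) • LinearMap.mul ℤ ℤ) r r' = (2 * n : ℕ)} ↦
      ∃ g : (B₀.prod ((-(2 * t : ℤ)) • LinearMap.mul ℤ ℤ)).IsometryEquiv (B₀.prod ((-(2 * t : ℤ)) • LinearMap.mul ℤ ℤ)),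
        g.discriminantGroupCongr = LinearEquiv.refl ℤ _ ∧ g r.1 = s.1) = 2 ^ n.primeFactors.card := by
  obtain ⟨r, r', hr, hr0, hrsat, hfr, hr'⟩ := hex
  obtain ⟨-, hft, hcop, hc, hd⟩ := divisor_data_of_w_eq_one t hu he ht hw hr hr0 hrsat hfr hr'
  rw [natCard_quot_stable_isometryEquiv_two_mul_of_divisor t hu he ht h d (f := 2 * n) (by omega) (by exact_mod_cast hft)]
  exact natCard_admissible_eq_two_pow_of_even hn hft hcop hc hd

end Lattice

/-! ### §4 The models `(E₈(−1)^{⊕m} ⊕ U^{⊕(k+2)}) ⊕ ℤ(−2t)` (`L_{2t}`: `m = 2`, `k = 1`) -/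

section Model

variable (m k t : ℕ)

/-- **Prop. 4.6 for `w = 1`, `f` odd, in the models**: `2^{ρ(f)}` `Õ`-orbits of primitive `h` with `h² = 2d`, `(h, L) = fℤ` in
`(E₈(−1)^{⊕m} ⊕ U^{⊕(k+2)}) ⊕ ℤ(−2t)`, if one exists. [cite: GritsenkoHulekSankaran2010Symplectic, §4 Prop. 4.6 (i)–(iii)] -/
theorem natCard_quot_stable_isometryEquiv_model_two_mul_of_divisor_of_odd (ht : 0 < t) (d : ℤ) {f : ℕ} (hfo : Odd f)
    (hw : Int.gcd (Int.gcd (2 * t / f) (2 * d / f) : ℤ) f = 1)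
    (hex : ∃ r r' : ((Fin m → Fin 8 → ℤ) × ((Fin (k + 2) → ℤ) × (Fin (k + 2) → ℤ))) × ℤ,
      (((LinearMap.BilinForm.pi fun _ : Fin m ↦ -e8Form).prod (hyperbolicSum (k + 2))).prod
        ((-(2 * t : ℤ)) • LinearMap.mul ℤ ℤ)) r r = 2 * d ∧ r ≠ 0 ∧
      (∀ (a : ℤ) (w : ((Fin m → Fin 8 → ℤ) × ((Fin (k + 2) → ℤ) × (Fin (k + 2) → ℤ))) × ℤ), a ≠ 0 →
        a • w ∈ ℤ ∙ r → w ∈ ℤ ∙ r) ∧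
      (∀ z, (f : ℤ) ∣ (((LinearMap.BilinForm.pi fun _ : Fin m ↦ -e8Form).prod (hyperbolicSum (k + 2))).prod
        ((-(2 * t : ℤ)) • LinearMap.mul ℤ ℤ)) r z) ∧
      (((LinearMap.BilinForm.pi fun _ : Fin m ↦ -e8Form).prod (hyperbolicSum (k + 2))).prod
        ((-(2 * t : ℤ)) • LinearMap.mul ℤ ℤ)) r r' = f) :
    Nat.card (Quot fun r s : {r : ((Fin m → Fin 8 → ℤ) × ((Fin (k + 2) → ℤ) × (Fin (k + 2) → ℤ))) × ℤ //
        (((LinearMap.BilinForm.pi fun _ : Fin m ↦ -e8Form).prod (hyperbolicSum (k + 2))).prod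
          ((-(2 * t : ℤ)) • LinearMap.mul ℤ ℤ)) r r = 2 * d ∧ r ≠ 0 ∧
        (∀ (a : ℤ) (w : ((Fin m → Fin 8 → ℤ) × ((Fin (k + 2) → ℤ) × (Fin (k + 2) → ℤ))) × ℤ), a ≠ 0 →
          a • w ∈ ℤ ∙ r → w ∈ ℤ ∙ r) ∧
        (∀ z, (f : ℤ) ∣ (((LinearMap.BilinForm.pi fun _ : Fin m ↦ -e8Form).prod (hyperbolicSum (k + 2))).prod
          ((-(2 * t : ℤ)) • LinearMap.mul ℤ ℤ)) r z) ∧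
        ∃ r', (((LinearMap.BilinForm.pi fun _ : Fin m ↦ -e8Form).prod (hyperbolicSum (k + 2))).prod
          ((-(2 * t : ℤ)) • LinearMap.mul ℤ ℤ)) r r' = f} ↦
      ∃ g : ((((LinearMap.BilinForm.pi fun _ : Fin m ↦ -e8Form).prod (hyperbolicSum (k + 2))).prod
          ((-(2 * t : ℤ)) • LinearMap.mul ℤ ℤ))).IsometryEquiv
          ((((LinearMap.BilinForm.pi fun _ : Fin m ↦ -e8Form).prod (hyperbolicSum (k + 2))).prod
          ((-(2 * t : ℤ)) • LinearMap.mul ℤ ℤ))),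
        g.discriminantGroupCongr = LinearEquiv.refl ℤ _ ∧ g r.1 = s.1) = 2 ^ f.primeFactors.card := by
  obtain ⟨-, heB, huB⟩ := isSymm_isEven_isUnimodular_pi_neg_e8Form_prod_hyperbolicSum' m (k + 2)
  exact natCard_quot_stable_isometryEquiv_two_mul_of_divisor_of_odd t huB heB ht
    (twoHyperbolicPairs_pi_neg_e8Form_prod_hyperbolicSum_add_two m k) d hfo hw hex

/-- **Prop. 4.6 for `w = 1`, `f = 2n`, in the models**: `2^{ρ(n)}` `Õ`-orbits of primitive `h` with `h² = 2d`, `(h, L) = 2nℤ`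
in `(E₈(−1)^{⊕m} ⊕ U^{⊕(k+2)}) ⊕ ℤ(−2t)`, if one exists. [cite: GritsenkoHulekSankaran2010Symplectic, §4 Prop. 4.6 (ii)] -/
theorem natCard_quot_stable_isometryEquiv_model_two_mul_of_divisor_of_even (ht : 0 < t) (d : ℤ) {n : ℕ} (hn : 0 < n)
    (hw : Int.gcd (Int.gcd (2 * t / (2 * n)) (2 * d / (2 * n)) : ℤ) (2 * n) = 1)
    (hex : ∃ r r' : ((Fin m → Fin 8 → ℤ) × ((Fin (k + 2) → ℤ) × (Fin (k + 2) → ℤ))) × ℤ,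
      (((LinearMap.BilinForm.pi fun _ : Fin m ↦ -e8Form).prod (hyperbolicSum (k + 2))).prod
        ((-(2 * t : ℤ)) • LinearMap.mul ℤ ℤ)) r r = 2 * d ∧ r ≠ 0 ∧
      (∀ (a : ℤ) (w : ((Fin m → Fin 8 → ℤ) × ((Fin (k + 2) → ℤ) × (Fin (k + 2) → ℤ))) × ℤ), a ≠ 0 →
        a • w ∈ ℤ ∙ r → w ∈ ℤ ∙ r) ∧
      (∀ z, (2 * n : ℤ) ∣ (((LinearMap.BilinForm.pi fun _ : Fin m ↦ -e8Form).prod (hyperbolicSum (k + 2))).prod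
        ((-(2 * t : ℤ)) • LinearMap.mul ℤ ℤ)) r z) ∧
      (((LinearMap.BilinForm.pi fun _ : Fin m ↦ -e8Form).prod (hyperbolicSum (k + 2))).prod
        ((-(2 * t : ℤ)) • LinearMap.mul ℤ ℤ)) r r' = 2 * n) :
    Nat.card (Quot fun r s : {r : ((Fin m → Fin 8 → ℤ) × ((Fin (k + 2) → ℤ) × (Fin (k + 2) → ℤ))) × ℤ //
        (((LinearMap.BilinForm.pi fun _ : Fin m ↦ -e8Form).prod (hyperbolicSum (k + 2))).prod
          ((-(2 * t : ℤ)) • LinearMap.mul ℤ ℤ)) r r = 2 * d ∧ r ≠ 0 ∧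
        (∀ (a : ℤ) (w : ((Fin m → Fin 8 → ℤ) × ((Fin (k + 2) → ℤ) × (Fin (k + 2) → ℤ))) × ℤ), a ≠ 0 →
          a • w ∈ ℤ ∙ r → w ∈ ℤ ∙ r) ∧
        (∀ z, ((2 * n : ℕ) : ℤ) ∣ (((LinearMap.BilinForm.pi fun _ : Fin m ↦ -e8Form).prod (hyperbolicSum (k + 2))).prod
          ((-(2 * t : ℤ)) • LinearMap.mul ℤ ℤ)) r z) ∧
        ∃ r', (((LinearMap.BilinForm.pi fun _ : Fin m ↦ -e8Form).prod (hyperbolicSum (k + 2))).prod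
          ((-(2 * t : ℤ)) • LinearMap.mul ℤ ℤ)) r r' = (2 * n : ℕ)} ↦
      ∃ g : ((((LinearMap.BilinForm.pi fun _ : Fin m ↦ -e8Form).prod (hyperbolicSum (k + 2))).prod
          ((-(2 * t : ℤ)) • LinearMap.mul ℤ ℤ))).IsometryEquiv
          ((((LinearMap.BilinForm.pi fun _ : Fin m ↦ -e8Form).prod (hyperbolicSum (k + 2))).prod
          ((-(2 * t : ℤ)) • LinearMap.mul ℤ ℤ))),
        g.discriminantGroupCongr = LinearEquiv.refl ℤ _ ∧ g r.1 = s.1) = 2 ^ n.primeFactors.card := by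
  obtain ⟨-, heB, huB⟩ := isSymm_isEven_isUnimodular_pi_neg_e8Form_prod_hyperbolicSum' m (k + 2)
  exact natCard_quot_stable_isometryEquiv_two_mul_of_divisor_of_even t huB heB ht
    (twoHyperbolicPairs_pi_neg_e8Form_prod_hyperbolicSum_add_two m k) d hn hw hex

end Model

/-! ### §5 `f > 2`: the number of `Õ(L)`-orbits is even — "zero or strictly greater than one" (Example 4.10; row g44-#9) -/

section Parity

/-- A natural number that is even is `0` or at least `2`. [folklore] -/
private theorem Nat.eq_zero_or_two_le_of_even {n : ℕ} (h : Even n) : n = 0 ∨ 2 ≤ n := by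
  obtain ⟨k, rfl⟩ := h
  omega

/-- **For `f > 2` the admissible classes `{c ∈ (ℤ/f)^× : f² ∣ d + c²t}` come in pairs `±c`**, so their number is even:
`c ↦ −c` preserves admissibility (`f ∣ 2t` makes `f² ∣ d + c²t` a condition on `c mod f`) and has no fixed point, since
`c ≡ −c (mod f)` with `(c, f) = 1` forces `f ∣ 2`. (GHS: "If `f > 2`, then Proposition 4.6 shows that the number of orbits is
zero or strictly greater than one" — there read off from the counts (i)–(iii).) [cite: GritsenkoHulekSankaran2010Symplectic, §4 Example 4.10 (second paragraph) with Prop. 4.6] -/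
theorem even_natCard_admissible_of_two_lt {t : ℕ} {d : ℤ} {f : ℕ} (hf2 : 2 < f) (hft : (f : ℤ) ∣ 2 * t) :
    Even (Nat.card {c : ZMod f // IsUnit c ∧ (f : ℤ) ^ 2 ∣ d + t * (c.val : ℤ) ^ 2}) := by
  classical
  haveI : NeZero f := ⟨by omega⟩
  have hf0 : 0 < f := by omega
  -- admissibility of `−c`
  have hneg : ∀ c : ZMod f, (f : ℤ) ^ 2 ∣ d + t * (c.val : ℤ) ^ 2 → (f : ℤ) ^ 2 ∣ d + t * ((-c).val : ℤ) ^ 2 := by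
    intro c hc
    have h1 := (sq_dvd_add_mul_val_sq_iff t hf0 hft (-(c.val : ℤ)) d).2 (by rwa [neg_sq])
    rwa [Int.cast_neg, Int.cast_natCast, ZMod.natCast_zmod_val] at h1
  -- the involution `c ↦ −c` on the admissible classes
  let ι : Function.End {c : ZMod f // IsUnit c ∧ (f : ℤ) ^ 2 ∣ d + t * (c.val : ℤ) ^ 2} :=
    fun c ↦ ⟨-c.1, c.2.1.neg, hneg c.1 c.2.2⟩
  have hι : ι ^ 2 ^ 1 = 1 := by
    funext c
    change ι (ι c) = c
    exact Subtype.ext (neg_neg c.1)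
  haveI : Fact (Nat.Prime 2) := ⟨Nat.prime_two⟩
  have hmod := Equiv.Perm.card_fixedPoints_modEq (f := ι) hι
  -- no fixed point: `−c = c`, `c` a unit ⟹ `2 = 0` in `ℤ/f` ⟹ `f ∣ 2`
  have hfix : Fintype.card (Function.fixedPoints ι) = 0 := by
    rw [Fintype.card_eq_zero_iff]
    refine ⟨fun ⟨c, hc⟩ ↦ ?_⟩
    have h1 : -c.1 = c.1 := congr_arg Subtype.val hc
    obtain ⟨u, hu⟩ := c.2.1
    have h2 : (2 : ZMod f) * c.1 = 0 := by
      rw [two_mul]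
      nth_rw 1 [← h1]
      exact neg_add_cancel c.1
    have h3 : (2 : ZMod f) = 0 := by
      have h4 := congr_arg (· * (↑u⁻¹ : ZMod f)) h2
      simp only [zero_mul, mul_assoc, ← hu, Units.mul_inv, mul_one] at h4
      exact h4
    have h5 : f ∣ 2 := by
      rw [show (2 : ZMod f) = ((2 : ℕ) : ZMod f) by norm_num, ZMod.natCast_eq_zero_iff] at h3
      exact h3
    exact absurd (Nat.le_of_dvd two_pos h5) (by omega)
  rw [hfix] at hmod
  rw [Nat.card_eq_fintype_card, Nat.even_iff]
  exact hmod

variable {M : Type u} [AddCommGroup M] [Module.Finite ℤ M] [Module.Free ℤ M] {B₀ : BilinForm ℤ M} (t : ℕ)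

/-- **Example 4.10, second paragraph: for `f > 2` the number of `Õ(L)`-orbits of primitive `h ∈ L = B₀ ⊕ ⟨−2t⟩` with
`h² = 2d`, `(h, L) = fℤ` is EVEN** (the orbits correspond to the admissible `c mod f`, Prop. 4.6, which pair off under
`c ↦ −c`). `B₀` even unimodular with two orthogonal hyperbolic pairs, `t ≥ 1`, `f ∣ 2t`.
[cite: GritsenkoHulekSankaran2010Symplectic, §4 Example 4.10 ("If `f > 2`, then Proposition 4.6 shows that the number of orbits is zero or strictly greater than one")] -/
theorem even_natCard_quot_stable_isometryEquiv_two_mul_of_divisor_of_two_lt (hu : B₀.IsUnimodular) (he : B₀.IsEven)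
    (ht : 0 < t) {x y x₁ y₁ : M} (h : TwoHyperbolicPairs B₀ x y x₁ y₁) (d : ℤ) {f : ℕ} (hf2 : 2 < f)
    (hf : (f : ℤ) ∣ 2 * t) :
    Even (Nat.card (Quot fun r s : {r : M × ℤ // B₀.prod ((-(2 * t : ℤ)) • LinearMap.mul ℤ ℤ) r r = 2 * d ∧ r ≠ 0 ∧
        (∀ (k : ℤ) (w : M × ℤ), k ≠ 0 → k • w ∈ ℤ ∙ r → w ∈ ℤ ∙ r) ∧
        (∀ z, (f : ℤ) ∣ B₀.prod ((-(2 * t : ℤ)) • LinearMap.mul ℤ ℤ) r z) ∧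
        ∃ r', B₀.prod ((-(2 * t : ℤ)) • LinearMap.mul ℤ ℤ) r r' = f} ↦
      ∃ g : (B₀.prod ((-(2 * t : ℤ)) • LinearMap.mul ℤ ℤ)).IsometryEquiv (B₀.prod ((-(2 * t : ℤ)) • LinearMap.mul ℤ ℤ)),
        g.discriminantGroupCongr = LinearEquiv.refl ℤ _ ∧ g r.1 = s.1)) := by
  rw [natCard_quot_stable_isometryEquiv_two_mul_of_divisor t hu he ht h d (by omega) hf]
  exact even_natCard_admissible_of_two_lt hf2 hf

/-- **"If `f > 2`, then … the number of orbits is zero or strictly greater than one"** (`Õ(L)`-orbits of primitive `h` with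
`h² = 2d`, `(h, L) = fℤ` in `L = B₀ ⊕ ⟨−2t⟩`, `f ∣ 2t`). [cite: GritsenkoHulekSankaran2010Symplectic, §4 Example 4.10] -/
theorem natCard_quot_stable_isometryEquiv_two_mul_of_divisor_eq_zero_or_two_le (hu : B₀.IsUnimodular) (he : B₀.IsEven)
    (ht : 0 < t) {x y x₁ y₁ : M} (h : TwoHyperbolicPairs B₀ x y x₁ y₁) (d : ℤ) {f : ℕ} (hf2 : 2 < f)
    (hf : (f : ℤ) ∣ 2 * t) :
    Nat.card (Quot fun r s : {r : M × ℤ // B₀.prod ((-(2 * t : ℤ)) • LinearMap.mul ℤ ℤ) r r = 2 * d ∧ r ≠ 0 ∧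
        (∀ (k : ℤ) (w : M × ℤ), k ≠ 0 → k • w ∈ ℤ ∙ r → w ∈ ℤ ∙ r) ∧
        (∀ z, (f : ℤ) ∣ B₀.prod ((-(2 * t : ℤ)) • LinearMap.mul ℤ ℤ) r z) ∧
        ∃ r', B₀.prod ((-(2 * t : ℤ)) • LinearMap.mul ℤ ℤ) r r' = f} ↦
      ∃ g : (B₀.prod ((-(2 * t : ℤ)) • LinearMap.mul ℤ ℤ)).IsometryEquiv (B₀.prod ((-(2 * t : ℤ)) • LinearMap.mul ℤ ℤ)),
        g.discriminantGroupCongr = LinearEquiv.refl ℤ _ ∧ g r.1 = s.1) = 0 ∨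
    2 ≤ Nat.card (Quot fun r s : {r : M × ℤ // B₀.prod ((-(2 * t : ℤ)) • LinearMap.mul ℤ ℤ) r r = 2 * d ∧ r ≠ 0 ∧
        (∀ (k : ℤ) (w : M × ℤ), k ≠ 0 → k • w ∈ ℤ ∙ r → w ∈ ℤ ∙ r) ∧
        (∀ z, (f : ℤ) ∣ B₀.prod ((-(2 * t : ℤ)) • LinearMap.mul ℤ ℤ) r z) ∧
        ∃ r', B₀.prod ((-(2 * t : ℤ)) • LinearMap.mul ℤ ℤ) r r' = f} ↦
      ∃ g : (B₀.prod ((-(2 * t : ℤ)) • LinearMap.mul ℤ ℤ)).IsometryEquiv (B₀.prod ((-(2 * t : ℤ)) • LinearMap.mul ℤ ℤ)),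
        g.discriminantGroupCongr = LinearEquiv.refl ℤ _ ∧ g r.1 = s.1) :=
  Nat.eq_zero_or_two_le_of_even (even_natCard_quot_stable_isometryEquiv_two_mul_of_divisor_of_two_lt t hu he ht h d hf2 hf)

/-- **"Thus the cases `f = 1` and `f = 2` are special in that they are the only cases where the degree determines the
polarisation uniquely"**: if the primitive `h ∈ L = B₀ ⊕ ⟨−2t⟩` with `h² = 2d`, `(h, L) = fℤ` (`f ≥ 1`, `f ∣ 2t`) form exactly
one `Õ(L)`-orbit, then `f ≤ 2`. [cite: GritsenkoHulekSankaran2010Symplectic, §4 Example 4.10] -/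
theorem le_two_of_natCard_quot_stable_isometryEquiv_two_mul_of_divisor_eq_one (hu : B₀.IsUnimodular) (he : B₀.IsEven)
    (ht : 0 < t) {x y x₁ y₁ : M} (h : TwoHyperbolicPairs B₀ x y x₁ y₁) {d : ℤ} {f : ℕ} (hf : (f : ℤ) ∣ 2 * t)
    (h1 : Nat.card (Quot fun r s : {r : M × ℤ // B₀.prod ((-(2 * t : ℤ)) • LinearMap.mul ℤ ℤ) r r = 2 * d ∧ r ≠ 0 ∧
        (∀ (k : ℤ) (w : M × ℤ), k ≠ 0 → k • w ∈ ℤ ∙ r → w ∈ ℤ ∙ r) ∧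
        (∀ z, (f : ℤ) ∣ B₀.prod ((-(2 * t : ℤ)) • LinearMap.mul ℤ ℤ) r z) ∧
        ∃ r', B₀.prod ((-(2 * t : ℤ)) • LinearMap.mul ℤ ℤ) r r' = f} ↦
      ∃ g : (B₀.prod ((-(2 * t : ℤ)) • LinearMap.mul ℤ ℤ)).IsometryEquiv (B₀.prod ((-(2 * t : ℤ)) • LinearMap.mul ℤ ℤ)),
        g.discriminantGroupCongr = LinearEquiv.refl ℤ _ ∧ g r.1 = s.1) = 1) :
    f ≤ 2 := by
  by_contra hf2
  obtain ⟨k, hk⟩ := even_natCard_quot_stable_isometryEquiv_two_mul_of_divisor_of_two_lt t hu he ht h d (by omega) hf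
  omega

end Parity

/-! #### `f > 2` in the models `(E₈(−1)^{⊕m} ⊕ U^{⊕(k+2)}) ⊕ ℤ(−2t)` -/

section ParityModel

variable (m k t : ℕ)

/-- **`f > 2` ⟹ an even number of `Õ`-orbits** of primitive `h` with `h² = 2d`, `(h, L) = fℤ` (`f ∣ 2t`) in the models
`(E₈(−1)^{⊕m} ⊕ U^{⊕(k+2)}) ⊕ ℤ(−2t)`. [cite: GritsenkoHulekSankaran2010Symplectic, §4 Example 4.10] -/
theorem even_natCard_quot_stable_isometryEquiv_model_two_mul_of_divisor_of_two_lt (ht : 0 < t) (d : ℤ) {f : ℕ}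
    (hf2 : 2 < f) (hf : (f : ℤ) ∣ 2 * t) :
    Even (Nat.card (Quot fun r s : {r : ((Fin m → Fin 8 → ℤ) × ((Fin (k + 2) → ℤ) × (Fin (k + 2) → ℤ))) × ℤ //
        (((LinearMap.BilinForm.pi fun _ : Fin m ↦ -e8Form).prod (hyperbolicSum (k + 2))).prod
          ((-(2 * t : ℤ)) • LinearMap.mul ℤ ℤ)) r r = 2 * d ∧ r ≠ 0 ∧
        (∀ (a : ℤ) (w : ((Fin m → Fin 8 → ℤ) × ((Fin (k + 2) → ℤ) × (Fin (k + 2) → ℤ))) × ℤ), a ≠ 0 →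
          a • w ∈ ℤ ∙ r → w ∈ ℤ ∙ r) ∧
        (∀ z, (f : ℤ) ∣ (((LinearMap.BilinForm.pi fun _ : Fin m ↦ -e8Form).prod (hyperbolicSum (k + 2))).prod
          ((-(2 * t : ℤ)) • LinearMap.mul ℤ ℤ)) r z) ∧
        ∃ r', (((LinearMap.BilinForm.pi fun _ : Fin m ↦ -e8Form).prod (hyperbolicSum (k + 2))).prod
          ((-(2 * t : ℤ)) • LinearMap.mul ℤ ℤ)) r r' = f} ↦
      ∃ g : ((((LinearMap.BilinForm.pi fun _ : Fin m ↦ -e8Form).prod (hyperbolicSum (k + 2))).prod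
          ((-(2 * t : ℤ)) • LinearMap.mul ℤ ℤ))).IsometryEquiv
          ((((LinearMap.BilinForm.pi fun _ : Fin m ↦ -e8Form).prod (hyperbolicSum (k + 2))).prod
          ((-(2 * t : ℤ)) • LinearMap.mul ℤ ℤ))),
        g.discriminantGroupCongr = LinearEquiv.refl ℤ _ ∧ g r.1 = s.1)) := by
  obtain ⟨-, heB, huB⟩ := isSymm_isEven_isUnimodular_pi_neg_e8Form_prod_hyperbolicSum' m (k + 2)
  exact even_natCard_quot_stable_isometryEquiv_two_mul_of_divisor_of_two_lt t huB heB ht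
    (twoHyperbolicPairs_pi_neg_e8Form_prod_hyperbolicSum_add_two m k) d hf2 hf

/-- **One `Õ`-orbit ⟹ `f ≤ 2`** in the models `(E₈(−1)^{⊕m} ⊕ U^{⊕(k+2)}) ⊕ ℤ(−2t)` ("the only cases where the degree
determines the polarisation uniquely"). [cite: GritsenkoHulekSankaran2010Symplectic, §4 Example 4.10] -/
theorem le_two_of_natCard_quot_stable_isometryEquiv_model_two_mul_of_divisor_eq_one (ht : 0 < t) {d : ℤ} {f : ℕ}
    (hf : (f : ℤ) ∣ 2 * t)
    (h1 : Nat.card (Quot fun r s : {r : ((Fin m → Fin 8 → ℤ) × ((Fin (k + 2) → ℤ) × (Fin (k + 2) → ℤ))) × ℤ //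
        (((LinearMap.BilinForm.pi fun _ : Fin m ↦ -e8Form).prod (hyperbolicSum (k + 2))).prod
          ((-(2 * t : ℤ)) • LinearMap.mul ℤ ℤ)) r r = 2 * d ∧ r ≠ 0 ∧
        (∀ (a : ℤ) (w : ((Fin m → Fin 8 → ℤ) × ((Fin (k + 2) → ℤ) × (Fin (k + 2) → ℤ))) × ℤ), a ≠ 0 →
          a • w ∈ ℤ ∙ r → w ∈ ℤ ∙ r) ∧
        (∀ z, (f : ℤ) ∣ (((LinearMap.BilinForm.pi fun _ : Fin m ↦ -e8Form).prod (hyperbolicSum (k + 2))).prod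
          ((-(2 * t : ℤ)) • LinearMap.mul ℤ ℤ)) r z) ∧
        ∃ r', (((LinearMap.BilinForm.pi fun _ : Fin m ↦ -e8Form).prod (hyperbolicSum (k + 2))).prod
          ((-(2 * t : ℤ)) • LinearMap.mul ℤ ℤ)) r r' = f} ↦
      ∃ g : ((((LinearMap.BilinForm.pi fun _ : Fin m ↦ -e8Form).prod (hyperbolicSum (k + 2))).prod
          ((-(2 * t : ℤ)) • LinearMap.mul ℤ ℤ))).IsometryEquiv
          ((((LinearMap.BilinForm.pi fun _ : Fin m ↦ -e8Form).prod (hyperbolicSum (k + 2))).prod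
          ((-(2 * t : ℤ)) • LinearMap.mul ℤ ℤ))),
        g.discriminantGroupCongr = LinearEquiv.refl ℤ _ ∧ g r.1 = s.1) = 1) :
    f ≤ 2 := by
  obtain ⟨-, heB, huB⟩ := isSymm_isEven_isUnimodular_pi_neg_e8Form_prod_hyperbolicSum' m (k + 2)
  exact le_two_of_natCard_quot_stable_isometryEquiv_two_mul_of_divisor_eq_one t huB heB ht
    (twoHyperbolicPairs_pi_neg_e8Form_prod_hyperbolicSum_add_two m k) hf h1

end ParityModel

end Literature.Topology.FourManifolds
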